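import Summits.CriticalPhenomena.SAWScalingLimit.Theorems.SAWLoopFugacityFlowAvoidanceLimitExcursionRatioSelf

/-!
# The continuum excursion ratio near the two marked points:
# `G_{D'}(z,y)/G_D(z,y) → Φ'_A(0)` as `(z,y) → (a,b)` inside `D`
— helper file 1 of stub `stub_sphereRatioLimit` (S3b) of line `symplectic-fermion-anchor`
(crux `SAWLoopFugacityFlow.AvoidanceLimit`, stmt-CriticalPhenomena-10649)

The stub `stub_sphereRatioLimit` (lead c1 reshape S3b of `stub_excursionRatio`) asserts that the
ratio of killed simple-random-walk Green's functions `G^c_δ(z,y)/G_δ(z,y)` ("walk confined to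
`closure D'`" over "walk in `Ω_δ`") is uniformly within `η` of `d = Φ'_A(0)` at all pairs `(z, y)`
of the two lattice exit spheres of small radius `r` about the marked points `a = D.pt 0`,
`b = D.pt 1`, for small mesh `δ`. Its content splits into

* (i) CONTINUUM: the ratio of continuum Green's functions
  `ρ(z,y) = G_{D'}(z,y)/G_D(z,y) = G_{ℍ∖A}(φ⁻¹z, φ⁻¹y)/G_ℍ(φ⁻¹z, φ⁻¹y)` tends to `d` as
  `(z,y) → (a,b)` inside `D × D` — proved HERE;
* (ii) LATTICE: for fixed small `r`, `sup_{spheres} |G^c_δ/G_δ − ρ(δz, δy)| → 0` as `δ → 0+`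
  (an invariance principle for RATIOS of killed-SRW Green's functions uniform up to the part of
  `∂D` met by the spheres) — not in the tree; the companion file `…SphereRatioLimitReduction`
  proves `(ii) ⇒ stub` using this file.

Proof of (i): the landed half-plane limit `tendsto_greenHalfPlane_ratio`
(`…ExcursionRatioContinuum`: `G_{ℍ∖A}(u,v)/G_ℍ(u,v) → d` along `u → 0`, `v → ∞` inside `ℍ ∖ A`,
product filter, all directions of approach) composed with the inverse boundary correspondence of
the chordal uniformizer of the JORDAN domain `D` — `φ⁻¹ → 0` at `a` and `φ⁻¹ → ∞` at `b` within
`D` (Carathéodory; tree: `IsChordalUniformizing.tendsto_symm_nhds_zero/…cocompact`) — and the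
membership `φ⁻¹(z) ∈ ℍ ∖ A` for `z ∈ D` near `a, b` (ball agreement `D ∩ B(a,ε) = D' ∩ B(a,ε)`
puts such `z` in `D'`, and `ℍ ∖ A = φ⁻¹(D')`, `ConformalEquiv.diff_pullbackHull`). The point of
the Jordan hypothesis: EVERY point of `D` Euclidean-close to `a` is conformally close to the prime
end `a` (no fjord exception), which is what makes the sphere formulation of the stub correct.

* `eventually_symm_mem_diff_pullbackHull`, `tendsto_symm_nhdsWithin_pt_zero/one` — the two legs;
* `tendsto_greenRatioCont_nhdsWithin_pts` — (i) along `𝓝[D] a ×ˢ 𝓝[D] b`;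
* `nhdsWithin_carrier_eq_of_ball`, `tendsto_greenRatioCont_nhdsWithin_pts'` — the same along
  `𝓝[D'] a ×ˢ 𝓝[D'] b` (the two filters coincide by ball agreement);
* the registered closing theorem `greenRatioCont_near_pts` — the `η`–`r₀` form consumed by the
  reduction: `∀ η > 0, ∃ r₀ > 0`, `|ρ(z,y) − d| ≤ η` for `z, y ∈ D`, `|z − a| < r₀`, `|y − b| < r₀`.

Sources: G. F. Lawler, O. Schramm, W. Werner, *Conformal restriction: the chordal case*, JAMS 16
(2003), Prop. 4.1 [LawlerSchrammWerner2003Restriction]; Ch. Pommerenke, *Boundary Behaviour of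
Conformal Maps* (1992), Thm. 2.6 (Carathéodory) [PommerenkeBBCM1992]. No definitions.
-/

noncomputable section

open scoped BigOperators Topology symmDiff
open Filter Finset
open Literature.Probability.RandomPlanarGeometry Literature.Probability.LatticeModels

namespace Summit.CriticalPhenomena.SAWScalingLimit.Theorems.AvoidanceLimit.Anchor

/-! ## The two legs: `φ⁻¹ → 0` at `a`, `φ⁻¹ → ∞` at `b`, inside `ℍ ∖ A` -/

/-- **Ball agreement puts `φ⁻¹(z)` in `ℍ ∖ A` for `z ∈ D` near the centre `p`.** If
`D' ∩ B(p, ε) = D ∩ B(p, ε)` then every `z ∈ D ∩ B(p, ε)` lies in `D'`, so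
`φ⁻¹(z) ∈ φ⁻¹(D') = ℍ ∖ A` for the pulled-back hull `A` (`ConformalEquiv.diff_pullbackHull`,
`symm_mapsTo_pullbackDomain`). [folklore] -/
theorem eventually_symm_mem_diff_pullbackHull {D D' : DobrushinDomain} (hsub : D'.carrier ⊆ D.carrier)
    {p : ℂ} {ε : ℝ} (hε : 0 < ε)
    (hb : D'.carrier ∩ Metric.ball p ε = D.carrier ∩ Metric.ball p ε)
    (φ : ConformalEquiv UpperHalfPlane.upperHalfPlaneSet D.carrier) :
    ∀ᶠ z in 𝓝[D.carrier] p,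
      φ.symm z ∈ UpperHalfPlane.upperHalfPlaneSet \ φ.pullbackHull D' := by
  have h1 : ∀ᶠ z in 𝓝[D.carrier] p, z ∈ D.carrier := self_mem_nhdsWithin
  have h2 : ∀ᶠ z in 𝓝[D.carrier] p, z ∈ Metric.ball p ε :=
    mem_nhdsWithin_of_mem_nhds (Metric.ball_mem_nhds p hε)
  filter_upwards [h1, h2] with z hzD hzb
  have hD' : z ∈ D'.carrier := by
    have : z ∈ D'.carrier ∩ Metric.ball p ε := by rw [hb]; exact ⟨hzD, hzb⟩
    exact this.1
  rw [ConformalEquiv.diff_pullbackHull]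
  exact ConformalEquiv.symm_mapsTo_pullbackDomain hsub hD'

/-- **`φ⁻¹(z) → 0` inside `ℍ ∖ A` as `z → a` within `D`** (inverse boundary correspondence of
the chordal uniformizer of a Jordan domain at `a`, Carathéodory — the tree's
`IsChordalUniformizing.tendsto_symm_nhds_zero` — plus ball agreement at `a`).
[cite: PommerenkeBBCM1992, Thm. 2.6] -/
theorem tendsto_symm_nhdsWithin_pt_zero {D D' : DobrushinDomain} (hsub : D'.carrier ⊆ D.carrier)
    {ε : ℝ} (hε : 0 < ε)
    (hb0 : D'.carrier ∩ Metric.ball (D.pt 0) ε = D.carrier ∩ Metric.ball (D.pt 0) ε)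
    {φ : ConformalEquiv UpperHalfPlane.upperHalfPlaneSet D.carrier} (hφ : D.IsChordalUniformizing φ) :
    Tendsto φ.symm (𝓝[D.carrier] (D.pt 0))
      (𝓝[UpperHalfPlane.upperHalfPlaneSet \ φ.pullbackHull D'] 0) :=
  tendsto_nhdsWithin_iff.2
    ⟨hφ.tendsto_symm_nhds_zero, eventually_symm_mem_diff_pullbackHull hsub hε hb0 φ⟩

/-- **`φ⁻¹(z) → ∞` inside `ℍ ∖ A` as `z → b` within `D`** (inverse boundary correspondence at
`b`, `IsChordalUniformizing.tendsto_symm_cocompact`, plus ball agreement at `b`).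
[cite: PommerenkeBBCM1992, Thm. 2.6] -/
theorem tendsto_symm_nhdsWithin_pt_one {D D' : DobrushinDomain} (hsub : D'.carrier ⊆ D.carrier)
    {ε : ℝ} (hε : 0 < ε)
    (hb1 : D'.carrier ∩ Metric.ball (D.pt 1) ε = D.carrier ∩ Metric.ball (D.pt 1) ε)
    {φ : ConformalEquiv UpperHalfPlane.upperHalfPlaneSet D.carrier} (hφ : D.IsChordalUniformizing φ) :
    Tendsto φ.symm (𝓝[D.carrier] (D.pt 1))
      (cocompact ℂ ⊓ 𝓟 (UpperHalfPlane.upperHalfPlaneSet \ φ.pullbackHull D')) :=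
  tendsto_inf.2 ⟨hφ.tendsto_symm_cocompact,
    tendsto_principal.2 (eventually_symm_mem_diff_pullbackHull hsub hε hb1 φ)⟩

/-- The inline hull hypotheses of the stub give the tree's `IsHullSubdomain` (ball agreement ⇒
the marked points are off `closure (D ∖ D')`; as in `stub_excursionRatio_of_greenRatioInvariance`).
[folklore] -/
theorem isHullSubdomain_of_ballAgreement {D D' : DobrushinDomain} (hsub : D'.carrier ⊆ D.carrier)
    (h0 : D'.pt 0 = D.pt 0) (h1 : D'.pt 1 = D.pt 1) {ε : ℝ} (hε : 0 < ε)
    (hb0 : D'.carrier ∩ Metric.ball (D.pt 0) ε = D.carrier ∩ Metric.ball (D.pt 0) ε)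
    (hb1 : D'.carrier ∩ Metric.ball (D.pt 1) ε = D.carrier ∩ Metric.ball (D.pt 1) ε) :
    D.IsHullSubdomain D' := by
  have key : ∀ p : ℂ, D'.carrier ∩ Metric.ball p ε = D.carrier ∩ Metric.ball p ε →
      p ∉ closure (D.carrier \ D'.carrier) := by
    intro p hp hmem
    rw [mem_closure_iff_nhds] at hmem
    obtain ⟨z, hzb, hzD, hzD'⟩ := hmem (Metric.ball p ε) (Metric.ball_mem_nhds p hε)
    have hz : z ∈ D'.carrier ∩ Metric.ball p ε := by rw [hp]; exact ⟨hzD, hzb⟩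
    exact hzD' hz.1
  exact ⟨hsub, h0, h1, key _ hb0, key _ hb1⟩

/-! ## (i): the continuum ratio tends to `d` as `(z, y) → (a, b)` inside `D × D` -/

/-- **The continuum excursion ratio near the marked points.** For hull data `(D, D', φ, A, Φ, d)`
as in the crux (Jordan domain `D`, hull subdomain `D'` agreeing with `D` near `a = D.pt 0` and
`b = D.pt 1`, chordal uniformizer `φ`, pulled-back hull `A = closure (ℍ ∖ φ⁻¹D')`, restriction
map `Φ = Φ_A` with `d = Φ'_A(0)`), the ratio of continuum Green's functions
`ρ(z,y) = G_{ℍ∖A}(φ⁻¹z, φ⁻¹y)/G_ℍ(φ⁻¹z, φ⁻¹y)` (`= G_{D'}(z,y)/G_D(z,y)` by conformal invariance;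
`G_ℍ(u,v) = log(|u − v̄|/|u − v|)`) tends to `d` as `(z, y) → (a, b)` within `D × D`, in whatever
manner (fjords and tangential approach included): `tendsto_greenHalfPlane_ratio` at
`(u,v) → (0,∞)` inside `ℍ ∖ A` (a `*`-hull, `IsStarHull.pullbackHull`) composed with the two legs
above. This is `H_{D'}(a,b)/H_D(a,b) = Φ'_A(0)`, the restriction exponent `1` of the Brownian
excursion, read on Green's functions. [cite: LawlerSchrammWerner2003Restriction, Prop. 4.1 (p. 16)] -/
theorem tendsto_greenRatioCont_nhdsWithin_pts {D D' : DobrushinDomain} (hsub : D'.carrier ⊆ D.carrier)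
    (h0 : D'.pt 0 = D.pt 0) (h1 : D'.pt 1 = D.pt 1)
    (hball : ∃ ε : ℝ, 0 < ε ∧
      D'.carrier ∩ Metric.ball (D.pt 0) ε = D.carrier ∩ Metric.ball (D.pt 0) ε ∧
      D'.carrier ∩ Metric.ball (D.pt 1) ε = D.carrier ∩ Metric.ball (D.pt 1) ε)
    {φ : ConformalEquiv UpperHalfPlane.upperHalfPlaneSet D.carrier} (hφ : D.IsChordalUniformizing φ)
    {A : Set ℂ} (hA : A = closure (UpperHalfPlane.upperHalfPlaneSet \
      {z | z ∈ UpperHalfPlane.upperHalfPlaneSet ∧ φ z ∈ D'.carrier}))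
    {Φ : ConformalEquiv (UpperHalfPlane.upperHalfPlaneSet \ A) UpperHalfPlane.upperHalfPlaneSet}
    {d : ℝ} (hΦ : IsRestrictionMap A Φ) (hd : HasRestrictionDeriv A Φ d) :
    Tendsto (fun p : ℂ × ℂ =>
        Real.log (‖Φ (φ.symm p.1) - (starRingEnd ℂ) (Φ (φ.symm p.2))‖ /
            ‖Φ (φ.symm p.1) - Φ (φ.symm p.2)‖) /
          Real.log (‖φ.symm p.1 - (starRingEnd ℂ) (φ.symm p.2)‖ / ‖φ.symm p.1 - φ.symm p.2‖))
      (𝓝[D.carrier] (D.pt 0) ×ˢ 𝓝[D.carrier] (D.pt 1)) (𝓝 d) := by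
  obtain ⟨ε, hε, hb0, hb1⟩ := hball
  have hHull : D.IsHullSubdomain D' := isHullSubdomain_of_ballAgreement hsub h0 h1 hε hb0 hb1
  have hA' : A = φ.pullbackHull D' := hA
  subst hA'
  have hstar : IsStarHull (φ.pullbackHull D') :=
    IsStarHull.pullbackHull JordanDomain.isSimplyConnected_holds hφ hHull
  -- the two legs, bundled into the product filter
  have hleg : Tendsto (fun p : ℂ × ℂ => (φ.symm p.1, φ.symm p.2))
      (𝓝[D.carrier] (D.pt 0) ×ˢ 𝓝[D.carrier] (D.pt 1))
      (𝓝[UpperHalfPlane.upperHalfPlaneSet \ φ.pullbackHull D'] 0 ×ˢ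
        (cocompact ℂ ⊓ 𝓟 (UpperHalfPlane.upperHalfPlaneSet \ φ.pullbackHull D'))) :=
    ((tendsto_symm_nhdsWithin_pt_zero hsub hε hb0 hφ).comp tendsto_fst).prodMk
      ((tendsto_symm_nhdsWithin_pt_one hsub hε hb1 hφ).comp tendsto_snd)
  have hcont := (tendsto_greenHalfPlane_ratio _ hstar Φ d hΦ hd).comp hleg
  refine hcont.congr fun p => ?_
  simp only [Function.comp_apply]

/-- Ball agreement at `p` makes the filters `𝓝[D] p` and `𝓝[D'] p` coincide (`D` and `D'` have
the same germ at `p`). [folklore] -/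
theorem nhdsWithin_carrier_eq_of_ball {D D' : DobrushinDomain} {p : ℂ} {ε : ℝ} (hε : 0 < ε)
    (hb : D'.carrier ∩ Metric.ball p ε = D.carrier ∩ Metric.ball p ε) :
    𝓝[D'.carrier] p = 𝓝[D.carrier] p := by
  rw [nhdsWithin_eq_iff_eventuallyEq]
  filter_upwards [Metric.ball_mem_nhds p hε] with z hz
  have key : (z ∈ D'.carrier ∩ Metric.ball p ε) = (z ∈ D.carrier ∩ Metric.ball p ε) := by rw [hb]
  simp only [Set.mem_inter_iff, hz, and_true] at key
  exact key

/-- **(i) along `𝓝[D'] a ×ˢ 𝓝[D'] b`** — the same limit within the hull subdomain `D'`, the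
natural domain of `ρ` (the two product filters coincide by ball agreement).
[cite: LawlerSchrammWerner2003Restriction, Prop. 4.1 (p. 16)] -/
theorem tendsto_greenRatioCont_nhdsWithin_pts' {D D' : DobrushinDomain} (hsub : D'.carrier ⊆ D.carrier)
    (h0 : D'.pt 0 = D.pt 0) (h1 : D'.pt 1 = D.pt 1)
    (hball : ∃ ε : ℝ, 0 < ε ∧
      D'.carrier ∩ Metric.ball (D.pt 0) ε = D.carrier ∩ Metric.ball (D.pt 0) ε ∧
      D'.carrier ∩ Metric.ball (D.pt 1) ε = D.carrier ∩ Metric.ball (D.pt 1) ε)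
    {φ : ConformalEquiv UpperHalfPlane.upperHalfPlaneSet D.carrier} (hφ : D.IsChordalUniformizing φ)
    {A : Set ℂ} (hA : A = closure (UpperHalfPlane.upperHalfPlaneSet \
      {z | z ∈ UpperHalfPlane.upperHalfPlaneSet ∧ φ z ∈ D'.carrier}))
    {Φ : ConformalEquiv (UpperHalfPlane.upperHalfPlaneSet \ A) UpperHalfPlane.upperHalfPlaneSet}
    {d : ℝ} (hΦ : IsRestrictionMap A Φ) (hd : HasRestrictionDeriv A Φ d) :
    Tendsto (fun p : ℂ × ℂ =>
        Real.log (‖Φ (φ.symm p.1) - (starRingEnd ℂ) (Φ (φ.symm p.2))‖ /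
            ‖Φ (φ.symm p.1) - Φ (φ.symm p.2)‖) /
          Real.log (‖φ.symm p.1 - (starRingEnd ℂ) (φ.symm p.2)‖ / ‖φ.symm p.1 - φ.symm p.2‖))
      (𝓝[D'.carrier] (D.pt 0) ×ˢ 𝓝[D'.carrier] (D.pt 1)) (𝓝 d) := by
  obtain ⟨ε, hε, hb0, hb1⟩ := hball
  rw [nhdsWithin_carrier_eq_of_ball hε hb0, nhdsWithin_carrier_eq_of_ball hε hb1]
  exact tendsto_greenRatioCont_nhdsWithin_pts hsub h0 h1 ⟨ε, hε, hb0, hb1⟩ hφ hA hΦ hd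

/-! ## Registered closing theorem: the `η`–`r₀` form -/

/-- **Registered closing theorem of this helper file — the continuum half of `stub_sphereRatioLimit`
in `η`–`r₀` form.** For hull data as in the stub and every `η > 0` there is `r₀ > 0` such that
`|ρ(z, y) − d| ≤ η` for all `z, y ∈ D` with `|z − a| < r₀`, `|y − b| < r₀`, where
`ρ(z,y) = log(|Φφ⁻¹z − conj Φφ⁻¹y|/|Φφ⁻¹z − Φφ⁻¹y|)/log(|φ⁻¹z − conj φ⁻¹y|/|φ⁻¹z − φ⁻¹y|)` is the
ratio of continuum Green's functions `G_{D'}(z,y)/G_D(z,y)`. In particular it holds at the mesh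
points `δz, δy ∈ D` of the two lattice exit spheres `r ≤ |δz − a| < r + δ`, `r ≤ |δy − b| < r + δ`
as soon as `r + δ < r₀` — uniformly, sphere points next to `∂D` included (Jordan domain: Euclidean
proximity to `a` is conformal proximity to the prime end `a`).
[cite: LawlerSchrammWerner2003Restriction, Prop. 4.1 (p. 16)] -/
theorem greenRatioCont_near_pts :
    ∀ (D D' : DobrushinDomain), D'.carrier ⊆ D.carrier → D'.pt 0 = D.pt 0 → D'.pt 1 = D.pt 1 →
      (∃ ε : ℝ, 0 < ε ∧ D'.carrier ∩ Metric.ball (D.pt 0) ε = D.carrier ∩ Metric.ball (D.pt 0) ε ∧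
        D'.carrier ∩ Metric.ball (D.pt 1) ε = D.carrier ∩ Metric.ball (D.pt 1) ε) →
      ∀ (φ : ConformalEquiv UpperHalfPlane.upperHalfPlaneSet D.carrier), D.IsChordalUniformizing φ →
      ∀ (A : Set ℂ), A = closure (UpperHalfPlane.upperHalfPlaneSet \
        {z | z ∈ UpperHalfPlane.upperHalfPlaneSet ∧ φ z ∈ D'.carrier}) →
      ∀ (Φ : ConformalEquiv (UpperHalfPlane.upperHalfPlaneSet \ A) UpperHalfPlane.upperHalfPlaneSet)
        (d : ℝ), IsRestrictionMap A Φ → HasRestrictionDeriv A Φ d →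
      ∀ η : ℝ, 0 < η → ∃ r₀ : ℝ, 0 < r₀ ∧ ∀ z ∈ D.carrier, ∀ y ∈ D.carrier,
        dist z (D.pt 0) < r₀ → dist y (D.pt 1) < r₀ →
        |Real.log (‖Φ (φ.symm z) - (starRingEnd ℂ) (Φ (φ.symm y))‖ / ‖Φ (φ.symm z) - Φ (φ.symm y)‖) /
            Real.log (‖φ.symm z - (starRingEnd ℂ) (φ.symm y)‖ / ‖φ.symm z - φ.symm y‖) - d| ≤ η := by
  intro D D' hsub h0 h1 hball φ hφ A hA Φ d hΦ hd η hη
  have h := tendsto_greenRatioCont_nhdsWithin_pts hsub h0 h1 hball hφ hA hΦ hd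
  have hmem := h (Metric.closedBall_mem_nhds d hη)
  rw [Filter.mem_map, Filter.mem_prod_iff] at hmem
  obtain ⟨s, hs, t, ht, hst⟩ := hmem
  rw [Metric.mem_nhdsWithin_iff] at hs ht
  obtain ⟨r₁, hr₁, hs₁⟩ := hs
  obtain ⟨r₂, hr₂, ht₂⟩ := ht
  refine ⟨min r₁ r₂, lt_min hr₁ hr₂, fun z hz y hy hzd hyd => ?_⟩
  have hzs : z ∈ s := hs₁ ⟨Metric.mem_ball.2 (lt_of_lt_of_le hzd (min_le_left _ _)), hz⟩
  have hyt : y ∈ t := ht₂ ⟨Metric.mem_ball.2 (lt_of_lt_of_le hyd (min_le_right _ _)), hy⟩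
  have key := hst (Set.mk_mem_prod hzs hyt)
  rw [Set.mem_preimage, Metric.mem_closedBall, Real.dist_eq] at key
  exact key

end Summit.CriticalPhenomena.SAWScalingLimit.Theorems.AvoidanceLimit.Anchor

end
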